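import Summits.CriticalPhenomena.PercolationContinuityZ3.Theorems.PercNearOneGluingNoHeavyPcintKingRouteSkeleton
import Literature.Probability.Percolation.SitePercolationMeasure
import HarnessLib

/-!
# PCINT lane, king route, K1 step (6b): the `ℤ²∗` side of the box inequality as a `P_p`-probability

Cell `prim-pcint`, seat `prim-pcint-1` (gen 9); memo `run/shared/lean/prim/pcint/KING-ROUTE.md` §K1 (6).

The right-hand side of `KingRoute.sum_wt_reach_le_sum_mu_starPath` for the PRODUCT weight
`pairWt p w = ∏_v bern p (w v).1 · bern p (w v).2` on the pair states `w : Λ → Bool × Bool` is the probability, under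
site percolation `P_p` on `ℤ²` (the vertex set of `ℤ²∗`), of the event `starPathEvent Λ o B`: an open `∗`-path through
pair sites of `Λ` from a site of the pair of `o` to a site of the pair of some `v ∈ B`
(`KingRoute.sum_pairWt_starPath_le_real_starPathEvent`).  Ingredients: the pair sites `pairSites Λ` (injective image of
`Λ × Bool` under `KingPairs.pairSite`), the equivalence `pairCfgEquiv` between pair states and `Prop`-configurations
on `pairSites Λ` (whose lift is `VdBEProcess.cfg`), the weight identity `siteWeight_pairCfgEquiv`, and the tree's
finite-sum formula `sitePercolation_real_eq_sum`.
-/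

noncomputable section

namespace Summit.CriticalPhenomena.PercolationContinuityZ3.Theorems.Pcint

namespace KingRoute

open Finset AdaptDom ClusterExpl KingPairs VdBEProcess Literature.Probability.Percolation Literature.Probability.LatticeModels

variable (Λ : Finset (Site 2))

/-- The `ℤ²∗`-sites of the pairs of the sites of `Λ`. -/
def pairSites : Finset (Site 2) := (Λ.attach ×ˢ (univ : Finset Bool)).image fun z => pairSite z.1.1 z.2

/-- The pair sites of `v ∈ Λ` belong to `pairSites Λ`. -/
theorem pairSite_mem_pairSites (v : ↥Λ) (i : Bool) : pairSite v.1 i ∈ pairSites Λ :=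
  mem_image.2 ⟨(v, i), mem_product.2 ⟨mem_attach _ _, mem_univ _⟩, rfl⟩

/-- Every pair site comes from a unique pair: the preimage data of a pair site. -/
theorem exists_eq_pairSite_of_mem {s : Site 2} (hs : s ∈ pairSites Λ) : ∃ v : ↥Λ, ∃ i : Bool, s = pairSite v.1 i := by
  obtain ⟨⟨v, i⟩, -, h⟩ := mem_image.1 hs
  exact ⟨v, i, h.symm⟩

/-- The open pair sites of `w` are pair sites. -/
theorem cfg_subset_pairSites (w : ↥Λ → Bool × Bool) : cfg Λ w ⊆ ↑(pairSites Λ) := by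
  rintro s ⟨v, ⟨rfl, -⟩ | ⟨rfl, -⟩⟩
  · exact pairSite_mem_pairSites Λ v false
  · exact pairSite_mem_pairSites Λ v true

/-- The product prior weight of a pair-state assignment: each of the two sites of each pair open with probability `p`. -/
def pairWt (p : ℝ) (w : ↥Λ → Bool × Bool) : ℝ := ∏ v, bern p (w v).1 * bern p (w v).2

/-- **The `∗`-path event** on `ℤ²`-site configurations: an open `∗`-path through pair sites of `Λ` from a site of the
pair of `o` to a site of the pair of some `v ∈ B`. -/
def starPathEvent (o : ↥Λ) (B : Finset ↥Λ) : Set (Set (Site 2)) :=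
  {ω | ∃ v ∈ B, ∃ i j : Bool, PathIn zdStarGraph (ω ∩ ↑(pairSites Λ)) (pairSite o.1 i) (pairSite v.1 j)}

/-- The `∗`-path event is determined by the pair sites. -/
theorem determinedBy_starPathEvent (o : ↥Λ) (B : Finset ↥Λ) :
    DeterminedBy (starPathEvent Λ o B) ↑(pairSites Λ) := by
  rw [determinedBy_iff]
  intro ω ω' h
  simp only [starPathEvent, Set.mem_setOf_eq, h]

/-- The `Prop`-configuration on the pair sites of a pair-state assignment: `s` is open iff `s ∈ cfg w`. -/
def pairCfg (w : ↥Λ → Bool × Bool) : ↥(pairSites Λ) → Prop := fun s => s.1 ∈ cfg Λ w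

/-- The pair-state assignment of a `Prop`-configuration on the pair sites. -/
def pairOfCfg (y : ↥(pairSites Λ) → Prop) : ↥Λ → Bool × Bool := fun v =>
  (@decide (y ⟨pairSite v.1 false, pairSite_mem_pairSites Λ v false⟩) (Classical.dec _),
   @decide (y ⟨pairSite v.1 true, pairSite_mem_pairSites Λ v true⟩) (Classical.dec _))

/-- `pairCfg` at a pair site. -/
theorem pairCfg_pairSite (w : ↥Λ → Bool × Bool) (v : ↥Λ) (i : Bool) :
    pairCfg Λ w ⟨pairSite v.1 i, pairSite_mem_pairSites Λ v i⟩ ↔ (if i then (w v).2 else (w v).1) = true := by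
  unfold pairCfg
  cases i
  · simp only [Bool.false_eq_true, ↓reduceIte]; exact pairSite_false_mem_cfg
  · simp only [↓reduceIte]; exact pairSite_true_mem_cfg

/-- **Pair states ≃ `Prop`-configurations on the pair sites.** -/
def pairCfgEquiv : (↥Λ → Bool × Bool) ≃ (↥(pairSites Λ) → Prop) where
  toFun := pairCfg Λ
  invFun := pairOfCfg Λ
  left_inv w := by
    funext v
    have h0 := pairCfg_pairSite Λ w v false
    have h1 := pairCfg_pairSite Λ w v true
    simp only [Bool.false_eq_true, ↓reduceIte] at h0 h1
    unfold pairOfCfg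
    refine Prod.ext ?_ ?_
    · show @decide _ (Classical.dec _) = (w v).1
      cases hb : (w v).1
      · rw [hb] at h0; simp only [Bool.false_eq_true, iff_false] at h0; simp [h0]
      · rw [hb] at h0; simp only [iff_true] at h0; simp [h0]
    · show @decide _ (Classical.dec _) = (w v).2
      cases hb : (w v).2
      · rw [hb] at h1; simp only [Bool.false_eq_true, iff_false] at h1; simp [h1]
      · rw [hb] at h1; simp only [iff_true] at h1; simp [h1]
  right_inv y := by
    funext s
    obtain ⟨v, i, hs⟩ := exists_eq_pairSite_of_mem Λ s.2
    have hs' : s = ⟨pairSite v.1 i, pairSite_mem_pairSites Λ v i⟩ := Subtype.ext hs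
    subst hs'
    apply propext
    rw [pairCfg_pairSite]
    unfold pairOfCfg
    cases i <;> simp

variable {Λ}

/-- The lift of `pairCfg w` to `ℤ²` is `cfg w`. -/
theorem liftSiteConfig_pairCfg (w : ↥Λ → Bool × Bool) :
    {s | liftSiteConfig (pairSites Λ) (pairCfg Λ w) s} = cfg Λ w := by
  ext s
  simp only [Set.mem_setOf_eq, liftSiteConfig, pairCfg]
  constructor
  · rintro ⟨-, h⟩; exact h
  · intro h; exact ⟨cfg_subset_pairSites Λ w h, h⟩

/-- **The tree's product weight on the pair sites is `pairWt`.** -/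
theorem siteWeight_pairCfgEquiv (p : unitInterval) (w : ↥Λ → Bool × Bool) :
    siteWeight p (pairCfgEquiv Λ w) = pairWt Λ (p : ℝ) w := by
  classical
  unfold siteWeight pairWt
  -- reindex the product over pair sites by `Λ × Bool`
  let e : ↥Λ × Bool ≃ ↥(pairSites Λ) :=
    Equiv.ofBijective (fun z => ⟨pairSite z.1.1 z.2, pairSite_mem_pairSites Λ z.1 z.2⟩)
      ⟨fun z z' h => by
        have := pairSite_injective (a₁ := (z.1.1, z.2)) (a₂ := (z'.1.1, z'.2)) (congrArg Subtype.val h)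
        simp only [Prod.mk.injEq] at this
        exact Prod.ext (Subtype.ext this.1) this.2,
       fun s => by
        obtain ⟨v, i, hs⟩ := exists_eq_pairSite_of_mem Λ s.2
        exact ⟨(v, i), Subtype.ext hs.symm⟩⟩
  rw [← Fintype.prod_equiv e (fun z => (bernoulliProp p).real {pairCfgEquiv Λ w (e z)}) _ (fun z => rfl)]
  rw [Fintype.prod_prod_type]
  refine Finset.prod_congr rfl fun v _ => ?_
  rw [Fintype.prod_bool]
  have hf : (bernoulliProp p).real {pairCfgEquiv Λ w (e (v, false))} = bern (p : ℝ) (w v).1 := by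
    change (bernoulliProp p).real {pairCfg Λ w ⟨pairSite v.1 false, _⟩} = _
    have h := pairCfg_pairSite Λ w v false
    simp only [Bool.false_eq_true, ↓reduceIte] at h
    unfold bern
    cases hw : (w v).1
    · rw [hw] at h
      have : pairCfg Λ w ⟨pairSite v.1 false, pairSite_mem_pairSites Λ v false⟩ = False := propext (by simpa using h)
      rw [this]; simp
    · rw [hw] at h
      have : pairCfg Λ w ⟨pairSite v.1 false, pairSite_mem_pairSites Λ v false⟩ = True := propext (by simpa using h)
      rw [this]; simp
  have ht : (bernoulliProp p).real {pairCfgEquiv Λ w (e (v, true))} = bern (p : ℝ) (w v).2 := by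
    change (bernoulliProp p).real {pairCfg Λ w ⟨pairSite v.1 true, _⟩} = _
    have h := pairCfg_pairSite Λ w v true
    simp only [↓reduceIte] at h
    unfold bern
    cases hw : (w v).2
    · rw [hw] at h
      have : pairCfg Λ w ⟨pairSite v.1 true, pairSite_mem_pairSites Λ v true⟩ = False := propext (by simpa using h)
      rw [this]; simp
    · rw [hw] at h
      have : pairCfg Λ w ⟨pairSite v.1 true, pairSite_mem_pairSites Λ v true⟩ = True := propext (by simpa using h)
      rw [this]; simp
  rw [hf, ht, mul_comm]

open Classical in
/-- **The `ℤ²∗` side of the box inequality**: the `pairWt`-weight of the pair-state assignments with an open `∗`-path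
of `cfg w` from the pair of `o` to the pair of a site of `B` is at most (in fact equal to) `P_p(starPathEvent Λ o B)`. -/
theorem sum_pairWt_starPath_le_real_starPathEvent (p : unitInterval) (o : ↥Λ) (B : Finset ↥Λ) :
    ∑ w : ↥Λ → Bool × Bool, pairWt Λ (p : ℝ) w *
        (if ∃ v ∈ B, ∃ i j : Bool, pairSite o.1 i ∈ cfg Λ w ∧ pairSite v.1 j ∈ cfg Λ w ∧
            PathIn zdStarGraph (cfg Λ w) (pairSite o.1 i) (pairSite v.1 j) then (1 : ℝ) else 0) ≤
      (sitePercolation (Site 2) p).real (starPathEvent Λ o B) := by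
  rw [sitePercolation_real_eq_sum p (determinedBy_starPathEvent Λ o B)]
  set E := starPathEvent Λ o B with hE
  have hwt : ∀ w : ↥Λ → Bool × Bool, 0 ≤ pairWt Λ (p : ℝ) w := fun w =>
    Finset.prod_nonneg fun v _ => mul_nonneg (bern_nonneg p.2.1 p.2.2 _) (bern_nonneg p.2.1 p.2.2 _)
  -- the `∗`-path condition on `cfg w` is the trace condition on `pairCfgEquiv w`
  have htrace : ∀ w : ↥Λ → Bool × Bool,
      (∃ v ∈ B, ∃ i j : Bool, pairSite o.1 i ∈ cfg Λ w ∧ pairSite v.1 j ∈ cfg Λ w ∧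
          PathIn zdStarGraph (cfg Λ w) (pairSite o.1 i) (pairSite v.1 j)) →
        pairCfgEquiv Λ w ∈ traceEvent (pairSites Λ) E := by
    rintro w ⟨v, hv, i, j, -, -, hp⟩
    change {s | liftSiteConfig (pairSites Λ) (pairCfg Λ w) s} ∈ E
    rw [liftSiteConfig_pairCfg]
    refine ⟨v, hv, i, j, hp.mono fun s hs => ⟨hs, cfg_subset_pairSites Λ w hs⟩⟩
  -- compare termwise with the indicator of the trace condition, then transport along `pairCfgEquiv`
  have step1 : ∑ w : ↥Λ → Bool × Bool, pairWt Λ (p : ℝ) w *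
        (if ∃ v ∈ B, ∃ i j : Bool, pairSite o.1 i ∈ cfg Λ w ∧ pairSite v.1 j ∈ cfg Λ w ∧
            PathIn zdStarGraph (cfg Λ w) (pairSite o.1 i) (pairSite v.1 j) then (1 : ℝ) else 0) ≤
      ∑ w ∈ univ.filter (fun w : ↥Λ → Bool × Bool => pairCfgEquiv Λ w ∈ traceEvent (pairSites Λ) E),
        pairWt Λ (p : ℝ) w := by
    rw [Finset.sum_filter]
    refine Finset.sum_le_sum fun w _ => ?_
    by_cases h : ∃ v ∈ B, ∃ i j : Bool, pairSite o.1 i ∈ cfg Λ w ∧ pairSite v.1 j ∈ cfg Λ w ∧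
        PathIn zdStarGraph (cfg Λ w) (pairSite o.1 i) (pairSite v.1 j)
    · rw [if_pos h, if_pos (htrace w h), mul_one]
    · rw [if_neg h, mul_zero]; split_ifs
      · exact hwt w
      · exact le_rfl
  have step2 : ∑ w ∈ univ.filter (fun w : ↥Λ → Bool × Bool => pairCfgEquiv Λ w ∈ traceEvent (pairSites Λ) E),
        pairWt Λ (p : ℝ) w =
      ∑ y ∈ (univ.filter (fun w : ↥Λ → Bool × Bool => pairCfgEquiv Λ w ∈ traceEvent (pairSites Λ) E)).map
        (pairCfgEquiv Λ).toEmbedding, siteWeight p y := by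
    rw [Finset.sum_map]
    exact Finset.sum_congr rfl fun w _ => by rw [Equiv.coe_toEmbedding, siteWeight_pairCfgEquiv]
  refine step1.trans (step2.le.trans (Finset.sum_le_sum_of_subset_of_nonneg ?_ fun y _ _ => siteWeight_nonneg p y))
  intro y hy
  rw [Finset.mem_map] at hy
  obtain ⟨w, hw, rfl⟩ := hy
  exact mem_filter.2 ⟨by simp, (mem_filter.1 hw).2⟩

end KingRoute

end Summit.CriticalPhenomena.PercolationContinuityZ3.Theorems.Pcint

end
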